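import Literature.MathematicalPhysics.QuantumFieldTheory.Balaban1983to89.B9Eq349BlockDistanceWeight
import Literature.MathematicalPhysics.QuantumFieldTheory.Balaban1983to89.B9Eq349BlockMultipliers
import Literature.MathematicalPhysics.QuantumFieldTheory.Balaban1983to89.B9Eq3101CommutatorCauchyBlockDecay
import Literature.MathematicalPhysics.QuantumFieldTheory.Balaban1983to89.B9Eq387IMSLocalLettersLattice
import Literature.MathematicalPhysics.QuantumFieldTheory.Balaban1983to89.B9Eq316TowerFlatIsOneStep
import Literature.MathematicalPhysics.QuantumFieldTheory.Balaban1983to89.B11Eq103H1Complex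

/-!
# `Balaban1983to89.B9Eq349BondPointDecayFromCircle` — T. Bałaban, *Propagators for lattice gauge theories in a background field*, Commun. Math. Phys. **99**
# (1985) 389–434 [Balaban1985BackgroundPropagators] (3.49) p. 399, (3.101) p. 414: **POINT DECAY ON THE UNIT LATTICE OF COARSE BONDS FROM A UNIFORM
# COMBES–THOMAS CIRCLE LETTER** — the coarse-BOND twin of `B9Eq349PointDecayFromCircle` (sites): an operator `c` on `L²(Bond T_m; c₁)`, the point family
# `r_y` = the `d` bonds issuing from the coarse site `y`, and a conjugation bound `‖e^{κM′}ce^{−κM′}‖ ≤ C` uniform over the pair weights (fine site weight `χ` on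
# the torus `T_{Nm}` with bond increments `≤ ι`, coarse companion `χ′` with `|χ′(y) − χ(x)| ≤ ℓ′` on the block of `y`, `M′` the multiplier by `χ′(b′₋)`) and the
# circle `‖κ‖ = ρ` ⟹ `‖r_{y₁} ∘ c ∘ r_{y₀}‖ ≤ C·e^{ρ}·e^{−ρ·d_m(y₀,y₁)}`; §2 the same on ANY typing `P = fineP N m` of the fine torus (`subst` device of
# `B9Eq316TowerFlatIsOneStep`, for the tower `towerP L m (n+1) = fineP (L^(n+1)) m`).  The read-out both `(QG₁Q*)⁻¹` decay files of road ΔA-CT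
# (`B9Eq3126QG1QInvPointDecay`, one step; `…Tower`, every height) go through

statement-level skeleton of published theorems with citation tags; proofs where landed; nothing here is a claim about the Yang–Mills mass gap

CITATION HEADER (lean-in-tree rule).  Audit cell `pub-balaban`, sub-cell `t4`, BINDER row NE9 (road ΔA-CT; NE9 formalisation-swarm leaf prover 03
`b2b-balaban-t4-ne9-formalise-leaf-03` gen 75).  Proof text of §1 follows `B9Eq349PointDecayFromCircle` §1 letter for letter with `π := bpos` on the coarse
bonds (CREDIT: that file's authors, NE9 crew ne9-leaf-06 lineage).  Sources READ first-hand: [Balaban1985BackgroundPropagators] p. 399 (3.49) («e^{−δ₀|y−y′|}» —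
print's rate NOT asserted; the rate here is the radius of the circle the caller supplies), p. 414 (3.101).  Imports only BUILT modules (`B9Eq349BlockDistanceWeight`,
`B9Eq349BlockMultipliers`, `B9Eq3101CommutatorCauchyBlockDecay`, `B9Eq387IMSLocalLettersLattice`, `B9Eq316TowerFlatIsOneStep`, `B11Eq103H1Complex`).

WHAT IS PROVED (sorry-free; proof lane — no `def`; [folklore] Combes–Thomas ∕ Agmon read-out).
* §1 **`norm_bondPoint_le_exp_of_uniform_circle_bound`** — block size `L`, fine torus `T_{Lm}` typed `fineP L m`.
* §2 **`norm_bondPoint_le_exp_of_uniform_circle_bound_cast`** — the same on any typing `P = fineP N m` (weights on `TSite d P`, the block condition read through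
  `siteCast h`).
HONEST SCOPE.  Abstract operator `c`, abstract constant `C`, radius `ρ` = the caller's; nothing of print asserted; NOT NE9 (cell pub-balaban: NE9 NOT PRINTED ∕
NOT PROVED; «NE9 ⇐ the named binders»; row WALLED ON A MODEL (O-NE9-1; #5 UNRULED); spine PROVED 0∕9; rung (B)+1 on a finite T⁴ — NOT infinite volume, NOT
mass gap, NOT BetaPertH, NOT Clay; HONEST DEPENDENCY: continuum YM on T⁴ ⇐ BetaPertH ∧ nine spine estimates (0/9 proved); BetaPertH ⇐ (D1) ∧ (D4) ∧
CAP+tail).  NEW file; nothing modified.  Net new unproved facts: 0.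
-/

noncomputable section

open scoped InnerProductSpace ComplexConjugate
open NormedSpace

namespace Literature.MathematicalPhysics.QuantumFieldTheory.Balaban1983to89.B9Eq349BondPointDecayFromCircle

open B4Sect5Torus (TSite tdist)
open B9SectCLatticeCarrier (Bond bpos btgt)
open B9Eq311L2Pairing (WL2)
open B9Eq319QprimeTorus (fineP blockCoord centre blockCoord_centre)
open B9Eq316TowerFlatIsOneStep (siteCast siteCast_rfl)
open B11Eq103H1Complex (BondL2K)
open B9Eq387IMSLocalLettersLattice (exists_pointwise_clm)
open B9Eq349BlockDistanceWeight (exists_pairWeight)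
open B9Eq349BlockMultipliers (mul_comp_block_eq_smul block_comp_mul_eq_smul opNorm_block_le)
open B9Eq3101CommutatorCauchyBlockDecay (norm_block_le_of_conj_bound_abs)

variable {d : ℕ} (L : ℕ) [NeZero L] (m : Fin d → ℕ) {W : Type*} [NormedAddCommGroup W] [InnerProductSpace ℂ W] [FiniteDimensional ℂ W]
  {c₁ : ℝ} [Fact (0 < c₁)]

/-! ## §1 Point decay on the coarse bonds from a uniform circle letter -/

/-- **POINT DECAY ON THE COARSE BONDS FROM A UNIFORM CIRCLE LETTER**: `c : L²(Bond T_m) → L²(Bond T_m)`, the point family `r_y` (the bonds `b′` with `b′₋ = y`),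
and a conjugation bound `‖e^{κM′}ce^{−κM′}‖ ≤ C` holding for EVERY fine site weight `χ` with bond increments `≤ ι` (`ι ≥ 1∕L`), every coarse weight `χ′` with
`|χ′(y) − χ(x)| ≤ ℓ′` on the block of `y` (`ℓ′ ≥ 1`), `M′` the multiplier by `χ′(b′₋)`, and every `κ` on the circle `‖κ‖ = ρ` ⟹
`‖r_{y₁} ∘ c ∘ r_{y₀}‖ ≤ C·e^{ρ}·e^{−ρ·d_m(y₀,y₁)}` (pair weight of `B9Eq349BlockDistanceWeight`, read at the block centres). [folklore] (Combes–Thomas ∕ Agmon)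
[cite: Balaban1985BackgroundPropagators, (3.49) p.399, (3.101) p.414] -/
theorem norm_bondPoint_le_exp_of_uniform_circle_bound (hm : ∀ i, 1 ≤ m i)
    (c : BondL2K ℂ d m c₁ W →L[ℂ] BondL2K ℂ d m c₁ W)
    {r : TSite d m → BondL2K ℂ d m c₁ W →L[ℂ] BondL2K ℂ d m c₁ W}
    (hr : ∀ (y : TSite d m) (g : BondL2K ℂ d m c₁ W) (b' : Bond d m),
      WL2.equiv ℂ (fun _ : Bond d m => c₁) W (r y g) b' = if bpos b' = y then WL2.equiv ℂ (fun _ : Bond d m => c₁) W g b' else 0)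
    {ρ C ι ℓ' : ℝ} (hρ : 0 ≤ ρ) (hC0 : 0 ≤ C) (hι : 1 / (L : ℝ) ≤ ι) (hℓ' : 1 ≤ ℓ')
    (hC : ∀ (χ : TSite d (fineP L m) → ℝ) (χ' : TSite d m → ℝ),
      (∀ b : Bond d (fineP L m), |χ (bpos b) - χ (btgt b)| ≤ ι) →
      (∀ (y : TSite d m), ∀ x ∈ B9Eq319QprimeTorus.blockOf L m y, |χ' y - χ x| ≤ ℓ') →
      ∀ (MF : BondL2K ℂ d m c₁ W →L[ℂ] BondL2K ℂ d m c₁ W),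
      (∀ (g : BondL2K ℂ d m c₁ W) (b' : Bond d m),
        WL2.equiv ℂ (fun _ : Bond d m => c₁) W (MF g) b' = (χ' (bpos b') : ℂ) • WL2.equiv ℂ (fun _ : Bond d m => c₁) W g b') →
      ∀ κ : ℂ, ‖κ‖ = ρ → ‖exp (κ • MF) ∘L c ∘L exp (κ • (-MF))‖ ≤ C)
    (y₀ y₁ : TSite d m) :
    ‖r y₁ ∘L c ∘L r y₀‖ ≤ C * Real.exp ρ * Real.exp (-(ρ * tdist m y₀ y₁)) := by
  classical
  obtain ⟨χ, -, hχA, hχB, hχbond, -, hχcentre, hDlo, -⟩ := exists_pairWeight (L := L) hm y₀ y₁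
  set D : ℝ := max 0 ((L : ℝ) * tdist m y₀ y₁ - ((L : ℝ) - 1)) with hD
  obtain ⟨MF, hMF⟩ := exists_pointwise_clm (𝕜 := ℂ) (w := fun _ : Bond d m => c₁) (V := W)
    (fun b' : Bond d m => bpos b') (fun y => χ (centre L m y))
  have hCχ := hC χ (fun y => χ (centre L m y)) (fun b => (hχbond b).trans hι) (fun y x hx => (hχcentre y x hx).trans hℓ') MF hMF
  have hκp : ‖((ρ : ℝ) : ℂ)‖ = ρ := by rw [Complex.norm_real, Real.norm_eq_abs, abs_of_nonneg hρ]
  have hκm : ‖((-ρ : ℝ) : ℂ)‖ = ρ := by rw [Complex.norm_real, Real.norm_eq_abs, abs_neg, abs_of_nonneg hρ]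
  have hA : χ (centre L m y₀) = 0 := hχA _ (blockCoord_centre L m y₀)
  have hB : χ (centre L m y₁) = D / L := hχB _ (blockCoord_centre L m y₁)
  have hp : MF ∘L r y₀ = (((0 : ℝ) : ℂ)) • r y₀ :=
    mul_comp_block_eq_smul (π := fun b' : Bond d m => bpos b') hr hMF y₀ _ fun x hx => by
      show ((χ (centre L m (bpos x)) : ℝ) : ℂ) = ((0 : ℝ) : ℂ)
      rw [hx, hA]
  have hq : r y₁ ∘L MF = (((D / L : ℝ)) : ℂ) • r y₁ :=
    block_comp_mul_eq_smul (π := fun b' : Bond d m => bpos b') hr hMF y₁ _ fun x hx => by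
      show ((χ (centre L m (bpos x)) : ℝ) : ℂ) = ((D / L : ℝ) : ℂ)
      rw [hx, hB]
  have h := norm_block_le_of_conj_bound_abs MF MF c (r y₀) (r y₁) 0 (D / L) ρ hp hq (hCχ _ hκp) (hCχ _ hκm)
  have hDL : 0 ≤ D / L := div_nonneg (le_max_left _ _) (Nat.cast_nonneg _)
  rw [sub_zero, abs_of_nonneg hDL] at h
  have h1 : ‖r y₁ ∘L c ∘L r y₀‖ ≤ Real.exp (-(ρ * (D / L))) * C := by
    refine h.trans (mul_le_mul_of_nonneg_left ?_ (Real.exp_pos _).le)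
    calc ‖r y₁‖ * C * ‖r y₀‖ ≤ 1 * C * 1 := by
          gcongr
          · exact opNorm_block_le hr y₁
          · exact opNorm_block_le hr y₀
      _ = C := by ring
  refine h1.trans ?_
  rw [mul_comm, mul_assoc, ← Real.exp_add]
  refine mul_le_mul_of_nonneg_left (Real.exp_le_exp.mpr ?_) hC0
  nlinarith


/-! ## §2 The same on any typing `P = fineP N m` of the fine torus -/

/-- **… ON ANY TYPING `P = fineP N m` OF THE FINE TORUS** (`h`, e.g. `B9Eq316TowerFlatIsOneStep.towerP_eq_fineP_pow`): fine weights on `TSite d P` with bond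
increments `≤ ι` (`ι ≥ 1∕N`), the block condition read through `siteCast h`. [folklore] [cite: Balaban1985BackgroundPropagators, (3.49) p.399, (3.101) p.414] -/
theorem norm_bondPoint_le_exp_of_uniform_circle_bound_cast {P : Fin d → ℕ} {N : ℕ} [NeZero N] (h : P = fineP N m) (hm : ∀ i, 1 ≤ m i)
    (c : BondL2K ℂ d m c₁ W →L[ℂ] BondL2K ℂ d m c₁ W)
    {r : TSite d m → BondL2K ℂ d m c₁ W →L[ℂ] BondL2K ℂ d m c₁ W}
    (hr : ∀ (y : TSite d m) (g : BondL2K ℂ d m c₁ W) (b' : Bond d m),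
      WL2.equiv ℂ (fun _ : Bond d m => c₁) W (r y g) b' = if bpos b' = y then WL2.equiv ℂ (fun _ : Bond d m => c₁) W g b' else 0)
    {ρ C ι ℓ' : ℝ} (hρ : 0 ≤ ρ) (hC0 : 0 ≤ C) (hι : 1 / (N : ℝ) ≤ ι) (hℓ' : 1 ≤ ℓ')
    (hC : ∀ (χ : TSite d P → ℝ) (χ' : TSite d m → ℝ),
      (∀ b : Bond d P, |χ (bpos b) - χ (btgt b)| ≤ ι) →
      (∀ (y : TSite d m) (x : TSite d P), siteCast h x ∈ B9Eq319QprimeTorus.blockOf N m y → |χ' y - χ x| ≤ ℓ') →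
      ∀ (MF : BondL2K ℂ d m c₁ W →L[ℂ] BondL2K ℂ d m c₁ W),
      (∀ (g : BondL2K ℂ d m c₁ W) (b' : Bond d m),
        WL2.equiv ℂ (fun _ : Bond d m => c₁) W (MF g) b' = (χ' (bpos b') : ℂ) • WL2.equiv ℂ (fun _ : Bond d m => c₁) W g b') →
      ∀ κ : ℂ, ‖κ‖ = ρ → ‖exp (κ • MF) ∘L c ∘L exp (κ • (-MF))‖ ≤ C)
    (y₀ y₁ : TSite d m) :
    ‖r y₁ ∘L c ∘L r y₀‖ ≤ C * Real.exp ρ * Real.exp (-(ρ * tdist m y₀ y₁)) := by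
  subst h
  simp only [siteCast_rfl, Equiv.refl_apply] at hC
  exact norm_bondPoint_le_exp_of_uniform_circle_bound N m hm c hr hρ hC0 hι hℓ' (fun χ χ' hχ hχ' => hC χ χ' hχ fun y x hx => hχ' y x hx) y₀ y₁

end Literature.MathematicalPhysics.QuantumFieldTheory.Balaban1983to89.B9Eq349BondPointDecayFromCircle

end
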